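import Mathlib.RingTheory.DedekindDomain.FiniteAdeleRing
import Mathlib.RingTheory.Int.Basic
import Mathlib.RingTheory.PrincipalIdealDomain
import Mathlib.Data.Int.ConditionallyCompleteOrder
import Mathlib.Data.PNat.Basic
import Mathlib.Data.Real.Basic
import Mathlib.Order.WithBot
import HarnessLib

/-!
# The arithmetic site of Connes–Consani (2014, 2016): points, stalks, points over `ℝ₊^max` —
# statement layer

Topic `Literature/NumberTheory/ConnesConsani`. STATEMENT LEVEL: definitions with bodies, small proved
API lemmas, and NAMED FACTS (`def … : Prop`, no proof claimed) for the theorems, each with its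
locator. Sources: A. Connes, C. Consani, *The Arithmetic Site*, C. R. Math. 352 (2014) 971–975
[bib `ConnesConsani2014ArithmeticSite`] (announcement) and *Geometry of the arithmetic site*, Adv.
Math. 291 (2016) 274–329 = arXiv:1502.05580 [bib `ConnesConsani2016ArithmeticSite`]; numbering below
is that of the Adv. Math. paper.

## The objects, in the authors' words (what is typed, what is not)

* **Definition 3.1.** "The arithmetic site `𝒜 = (ℕ̂^×, ℤ_max)` is the topos `ℕ̂^×` [of sets with an
  action of the multiplicative monoid `ℕ^×`] endowed with the structure sheaf `𝒪 := ℤ_max`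
  [`= (ℤ ∪ {-∞}, max, +)`] viewed as a semiring in the topos using the action of `ℕ^×` by the
  Frobenius endomorphisms" `Fr_k(n) = kn`. TYPED: `ZMax := WithBot ℤ` (operations `⊔`, `+`),
  `zmaxFrobenius k`; an object of the topos is a type with `MulAction ℕ+`.
* **§2.1–2.2, Theorem 2.1.** Points of `ℕ̂^×` = flat (filtering) functors `ℕ^× → Sets` = `ℕ^×`-sets
  `X` with "(i) `X ≠ ∅`; (ii) for any `x, x' ∈ X` there exist `z ∈ X` and `k, k' ∈ ℕ^×` such that
  `kz = x`, `k'z = x'`; (iii) for `x ∈ X` and `k, k' ∈ ℕ^×`, the equality `kx = k'x` implies `k = k'`"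
  (TYPED: `IsToposPoint`). "**Theorem 2.1.** The category of points of the topos `ℕ̂^×` is canonically
  equivalent to the category of totally ordered groups isomorphic to non-trivial subgroups of
  `(ℚ, ℚ₊)` and injective morphisms of ordered groups." (Lemma 2.2: `X` is the strictly positive part
  `H_{>0}` of such an `H`, `k` acting by multiplication; Lemma 2.3: "any non-trivial ordered group
  morphism `φ : H → H'` is of the form `φ(x) = rx` … for some `r ∈ ℚ₊^×`".) TYPED as the named fact
  `ConnesConsani2016_thm_2_1` (objects); the model point `posCone H` and the non-vacuity lemma
  `isToposPoint_pnat` (the point `H = ℤ`) are PROVED.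
* **Proposition 2.5.** "(i) Any non-trivial subgroup of `ℚ` is uniquely of the form
  `H_a := {q ∈ ℚ | aq ∈ Ẑ}`, `a ∈ 𝔸^f/Ẑ*` […]. (ii) The map `a ↦ H_a` induces a canonical bijection of
  the quotient space `ℚ₊^× \ 𝔸^f/Ẑ*` with the set of isomorphism classes of points of the topos
  `ℕ̂^×`." TYPED: `finiteAdeleSubgroup a = H_a` over Mathlib's `FiniteAdeleRing ℤ ℚ` and the named
  fact `ConnesConsani2016_prop_2_5` (part (i); (ii) follows with Thm 2.1 and `H_{qa} = q⁻¹H_a`).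
* **Theorem 3.2** (stalks). "The stalk of the structure sheaf `𝒪` at the point of the topos `ℕ̂^×`
  associated to the ordered group `H ⊂ ℚ` is canonically isomorphic to the semiring
  `H_max := (H ∪ {-∞}, max, +)`." TYPED as the TYPE `WithBot H` of the stalk only (the geometric
  realisation `|ℤ_max|_F` and the map `β(x, y) = xy` are not typed). **Proposition 3.5.** "The global
  sections `Γ(ℕ̂^×, ℤ_max)` of the structure sheaf are given by the sub-semifield `𝔹 ⊂ ℤ_max`" —
  global sections = `ℕ^×`-invariant elements ([MM] I.6 (9)); the invariants are computed in the
  PROVED lemma `zmaxFrobenius_fixed_iff` (`= {-∞, 0} = 𝔹`).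
* **Definition 3.6.** "A point of `(Y, 𝒪_Y)` defined over `ℝ₊^max` is a pair given by a point `p` of
  `Y` and a morphism `f_p^# : 𝒪_{Y,p} → ℝ₊^max` of semirings." With Thm 3.2, at the point `H` this is
  a semiring morphism `H_max → ℝ_max = (ℝ ∪ {-∞}, max, +)` (TYPED: `MaxPlusHom H`).
  **Lemma 3.7.** "`Φ(a, λ) := λH_a` […] is a bijection between the quotient of `(𝔸^f/Ẑ*) × ℝ₊*` by the
  diagonal action of `ℚ₊^×` and the set of non zero subgroups of `ℝ` whose elements are pairwise
  commensurable." (TYPED: `realScaledSubgroup`, `IsCommensurableSubgroup`, named fact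
  `ConnesConsani2016_lemma_3_7`.) **Theorem 3.8** (= Thm 1.1; CRAS 2014 Thm 2.4 in the
  arXiv:1405.4527 numbering states the variant over `𝒪(ℝ₊^max)`, cf. Remark 3.9). "The points of the arithmetic site `𝒜` over `ℝ₊^max` form the quotient of the adèle class
  space of `ℚ` by the action of `Ẑ*`. The action of the Frobenius automorphisms `Fr_λ` of `ℝ₊^max` on
  these points corresponds to the action of the idèle class group on the above quotient." Proof,
  cases (α)/(β): a morphism `H_max → ℝ₊^max` either has range `𝔹` (degenerate point `ι_p`, fixed by
  all `Fr_λ`) or is injective with range determined by the rank-one subgroup `H' = λH ⊂ ℝ`, and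
  `Fr_μ` acts by `H' ↦ μH'`; so the points are `(ℚ₊^× \ 𝔸^f/Ẑ*) ⊔ ℚ₊^× \ (𝔸^f × ℝ₊*)/(Ẑ* × 1)
  = ℚ^× \ 𝔸_ℚ/(Ẑ* × 1)`. TYPED: the stalk-morphism classification `ConnesConsani2016_thm_3_8_stalkHom`
  (every `MaxPlusHom H` is `h ↦ λh` for a unique `λ ≥ 0`), which with Prop. 2.5 and Lemma 3.7 is the
  displayed bijection; the idèle-class/Frobenius equivariance is the formula `Fr_μ(Φ(a,λ)) = Φ(a,μλ)`.
* **§4, Theorem 4.2** (= [CC1]): the zeta function of the counting distribution `N(u)` of the fixed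
  points of the Frobenius on the points over `ℝ₊^max` is the complete zeta `ζ_ℚ(s) = π^{-s/2}Γ(s/2)ζ(s)`;
  and (§4.3, after Thm 4.2, verbatim) "**The main open question is at this point the definition of a
  suitable Weil cohomology which would allow one to understand the above equality as a Lefschetz
  formula.**" NOT TYPED (distributional trace; counting distribution).
* **§6–7: the square and the Frobenius correspondences.** Def. 6.10: "The unreduced square
  `(ℕ̂^{×2}, ℤ_min ⊗_𝔹 ℤ_min)`"; Prop. 6.11 (its points over `ℝ₊^max` = the square of the points);
  `ℤ_min ⊗_𝔹 ℤ_min ≅ Sub(ℤ × ℤ)` (finite unions of quadrants `I_x = {y ≥ x}`, operations `∪` and `+`,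
  Lemma 6.5/Prop. 6.6); Prop. 6.13: "`ℱ(λ, q)(Σ q^{n_i} ⊗ q^{m_i}) = q^α`, `α = inf(λn_i + m_i)`"
  is a semiring homomorphism to `ℝ₊^max`, its range `ℛ(λ)` is independent of `q`, and `ℛ(λ) ≅ ℛ(λ')`
  (`λ, λ' ∉ ℚ`) iff `λ' ∈ {λ, 1/λ}`; the FROBENIUS CORRESPONDENCE `Ψ(λ)` is the congruence
  `x ∼ y ⇔ ℱ(λ,q)(x) = ℱ(λ,q)(y)` on the (reduced) square (eq. after Remark 6.14; Def. 6.17), and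
  **Theorem 7.7 = Thm 1.2**: "`Ψ(λ) ∘ Ψ(λ') = Ψ(λλ')` if `λλ' ∉ ℚ` [or both rational];
  `Ψ(λ) ∘ Ψ(λ') = Id_ε ∘ Ψ(λλ')` when `λ, λ'` are irrational and `λλ' ∈ ℚ`." NOT TYPED here (tensor
  products of `𝔹`-modules, congruences and their composition); recorded for the autopsy: these
  correspondences are the programme's candidates for "divisors on the square", and NO intersection
  number, degree or linear-equivalence of such congruences is defined in the source.

## Design / Mathlib
`ℕ^×` is Mathlib's `ℕ+` acting through `MulAction ℕ+`; `𝔸^f = FiniteAdeleRing ℤ ℚ` (restricted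
product over `HeightOneSpectrum ℤ`), `Ẑ = ∏ ℤ_p` is the condition `a v ∈ v.adicCompletionIntegers ℚ`
for all `v`, `Ẑ*` the units integral together with their inverse (`IsZhatUnit`). `ℤ_max`, `H_max`,
`ℝ_max` are `WithBot ℤ`, `WithBot H`, `WithBot ℝ` with `⊔` and `+` (Mathlib's `Tropical (WithTop ·ᵒᵈ)`
would give the same semirings; we keep the statements instance-light). Topos-theoretic notions
(geometric morphisms, flat functors for a general site) are not formalised: following §2.2 of the
source, a point of `ℕ̂^×` IS an `ℕ^×`-set satisfying (i)–(iii).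

DISCHARGED at the end of this file (appended 2026-08-19): `ConnesConsani2016_thm_3_8_stalkHom_holds`,
`ConnesConsani2016_thm_2_1_holds`, `ConnesConsani2016_prop_2_5_holds` (place by place with
valuations instead of the source's Pontrjagin duality) and `ConnesConsani2016_lemma_3_7_holds`.
-/

noncomputable section

open IsDedekindDomain

universe u

namespace Literature.NumberTheory.ConnesConsani

/-! ## `ℤ_max` and its Frobenius endomorphisms (Def. 3.1, Prop. 3.5) -/

/-- The semifield `ℤ_max = (ℤ ∪ {-∞}, max, +)` of tropical integers, the structure sheaf of the
arithmetic site (as a type: `WithBot ℤ`, "addition" `⊔`, "multiplication" `+`, `-∞ = ⊥`).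
[cite: ConnesConsani2016ArithmeticSite, §1.1 and Def. 3.1] -/
abbrev ZMax : Type := WithBot ℤ

/-- The Frobenius endomorphism `Fr_k(n) := kn` of `ℤ_max` (`Fr_k(-∞) = -∞`), through which `ℕ^×`
acts on the structure sheaf: "`ℕ^× → End(ℤ_max)`, `k ↦ Fr_k(n) := kn`".
[cite: ConnesConsani2016ArithmeticSite, Def. 3.1] -/
def zmaxFrobenius (k : ℕ+) : ZMax → ZMax :=
  WithBot.map fun n : ℤ => (k : ℤ) * n

/-- `Fr_k(-∞) = -∞`. [folklore] -/
@[simp] theorem zmaxFrobenius_bot (k : ℕ+) : zmaxFrobenius k ⊥ = ⊥ := rfl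

/-- `Fr_k(n) = kn` on `ℤ ⊂ ℤ_max`. [folklore] -/
@[simp] theorem zmaxFrobenius_coe (k : ℕ+) (n : ℤ) :
    zmaxFrobenius k (n : ZMax) = (((k : ℤ) * n : ℤ) : ZMax) := rfl

/-- The `ℕ^×`-invariant elements of `ℤ_max` are exactly `-∞` and `0`, i.e. the Boolean semifield
`𝔹 = {-∞, 0} ⊂ ℤ_max`; by [MM] I.6 (9) these invariants are the global sections, which is
**Proposition 3.5**: "The global sections `Γ(ℕ̂^×, ℤ_max)` of the structure sheaf are given by the
sub-semifield `𝔹 ⊂ ℤ_max`." (The identification of global sections with invariants is not typed.)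
[cite: ConnesConsani2016ArithmeticSite, Prop. 3.5] -/
theorem zmaxFrobenius_fixed_iff (x : ZMax) :
    (∀ k : ℕ+, zmaxFrobenius k x = x) ↔ x = ⊥ ∨ x = (0 : ℤ) := by
  constructor
  · intro h
    induction x using WithBot.recBotCoe with
    | bot => exact Or.inl rfl
    | coe n =>
      right
      have h2 := h 2
      rw [zmaxFrobenius_coe] at h2
      have h2' : (2 : ℤ) * n = n := by exact_mod_cast h2
      have hn : n = 0 := by omega
      simp [hn]
  · rintro (rfl | rfl) k
    · rfl
    · rw [zmaxFrobenius_coe, mul_zero]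

/-! ## Points of the topos `ℕ̂^×` (§2.2, Theorem 2.1) -/

/-- **A point of the topos `ℕ̂^×`** (§2.2): an `ℕ^×`-set `X` whose category of elements is
filtering — "(i) `X ≠ ∅`. (ii) For any `x, x' ∈ X` there exist `z ∈ X` and `k, k' ∈ ℕ^×` such that
`kz = x`, `k'z = x'`. (iii) For `x ∈ X` and `k, k' ∈ ℕ^×`, the equality `kx = k'x` implies `k = k'`."
(Points of a presheaf topos `Ĉ` = flat functors `C → Sets`, §2.1; (iii) is the third flatness
condition simplified using that `ℕ^×` is cancellative, as noted in the source.)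
[cite: ConnesConsani2016ArithmeticSite, §2.2 (i)–(iii)] -/
structure IsToposPoint (X : Type u) [MulAction ℕ+ X] : Prop where
  /-- (i) `X ≠ ∅`. -/
  nonempty : Nonempty X
  /-- (ii) any two elements have a common "divisor". -/
  directed : ∀ x x' : X, ∃ (z : X) (k k' : ℕ+), k • z = x ∧ k' • z = x'
  /-- (iii) the action is free in the sense `kx = k'x ⇒ k = k'`. -/
  separated : ∀ (x : X) (k k' : ℕ+), k • x = k' • x → k = k'

/-- The strictly positive part `H_{>0}` of a subgroup `H ⊂ ℚ` — the `ℕ^×`-set attached to the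
ordered group `(H, H₊)` (Lemma 2.2: "`X = {h ∈ H | h > 0}`", `k` acting by `kx = x + ⋯ + x`).
[cite: ConnesConsani2016ArithmeticSite, Lemma 2.2] -/
def posCone (H : AddSubgroup ℚ) : Type := {q : ℚ // q ∈ H ∧ 0 < q}

/-- The action of `ℕ^×` on `H_{>0}` by multiplication. [cite: ConnesConsani2016ArithmeticSite, §2.2 and Lemma 2.2] -/
instance (H : AddSubgroup ℚ) : MulAction ℕ+ (posCone H) where
  smul k x := ⟨(k : ℕ) * x.1, by
    refine ⟨?_, mul_pos (by exact_mod_cast k.pos) x.2.2⟩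
    have : ((k : ℕ) : ℚ) * x.1 = (k : ℕ) • x.1 := by simp [nsmul_eq_mul]
    rw [this]
    exact H.nsmul_mem x.2.1 _⟩
  one_smul x := by
    apply Subtype.ext
    show ((1 : ℕ+) : ℕ) * x.1 = x.1
    simp
  mul_smul k k' x := by
    apply Subtype.ext
    show ((k * k' : ℕ+) : ℕ) * x.1 = ((k : ℕ) : ℚ) * (((k' : ℕ) : ℚ) * x.1)
    push_cast
    ring

/-- The action on `H_{>0}` in coordinates: `(k • x : ℚ) = k x`. [folklore] -/
@[simp] theorem posCone_smul_val (H : AddSubgroup ℚ) (k : ℕ+) (x : posCone H) :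
    ((k • x : posCone H).1 : ℚ) = (k : ℕ) * x.1 := rfl

/-- Non-vacuity / the point `H = ℤ`: `ℕ^×` acting on itself by multiplication is a point of `ℕ̂^×`
(condition (ii) with `z = 1`; (iii) by cancellation). This is the point whose isomorphism class is
the class of `1 ∈ 𝔸^f` in `ℚ₊^× \ 𝔸^f/Ẑ*` (Prop. 2.5 with `H_1 = ℤ`). [folklore] -/
theorem isToposPoint_pnat : IsToposPoint ℕ+ where
  nonempty := ⟨1⟩
  directed x x' := ⟨1, x, x', by simp, by simp⟩
  separated x k k' h := by
    have h' : k * x = k' * x := h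
    exact mul_right_cancel h'

/-- **Connes–Consani 2016, Theorem 2.1 (with Lemmas 2.2–2.3), objects.** "The category of points of
the topos `ℕ̂^×` is canonically equivalent to the category of totally ordered groups isomorphic to
non-trivial subgroups of `(ℚ, ℚ₊)` and injective morphisms of ordered groups": every point `X`
(flat `ℕ^×`-set) is `ℕ^×`-equivariantly isomorphic to `H_{>0}` for a non-trivial subgroup `H ⊂ ℚ`
(Lemma 2.2: the addition `x + x' := (k + k')z` for `kz = x`, `k'z = x'` makes `X` the strictly
positive part of a rank-one ordered group; Lemma 2.3: `H ↪ ℚ`, unique up to `ℚ₊^×`). The morphism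
part ("any non-trivial ordered group morphism `φ : H → H'` is of the form `φ(x) = rx` … `r ∈ ℚ₊^×`",
Lemma 2.3) is not restated as a separate fact. [cite: ConnesConsani2016ArithmeticSite, Thm. 2.1 (Lemmas 2.2–2.3)] -/
def ConnesConsani2016_thm_2_1 : Prop :=
  ∀ (X : Type u) [MulAction ℕ+ X], IsToposPoint X →
    ∃ H : AddSubgroup ℚ, H ≠ ⊥ ∧
      ∃ e : X ≃ posCone H, ∀ (k : ℕ+) (x : X), ((e (k • x)).1 : ℚ) = (k : ℕ) * (e x).1

/-! ## Adelic parametrisation of the points (Proposition 2.5) -/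

/-- `H_a := {q ∈ ℚ | aq ∈ Ẑ}` for a finite adèle `a ∈ 𝔸^f = FiniteAdeleRing ℤ ℚ`: the rational
numbers `q` with `a_v q ∈ ℤ_v` (= `v.adicCompletionIntegers ℚ`) at every finite place `v` (here
`v : HeightOneSpectrum ℤ`, the non-zero primes of `ℤ`). It depends only on the class of `a` modulo
`Ẑ*`. [cite: ConnesConsani2016ArithmeticSite, Prop. 2.5 (i), eq. (7)] -/
def finiteAdeleSubgroup (a : FiniteAdeleRing ℤ ℚ) : AddSubgroup ℚ where
  carrier := {q : ℚ | ∀ v : HeightOneSpectrum ℤ,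
    a v * algebraMap ℚ (v.adicCompletion ℚ) q ∈ v.adicCompletionIntegers ℚ}
  zero_mem' v := by simp
  add_mem' {q q'} hq hq' v := by
    rw [Set.mem_setOf_eq] at hq hq'
    rw [map_add, mul_add]
    exact add_mem (hq v) (hq' v)
  neg_mem' {q} hq v := by
    rw [Set.mem_setOf_eq] at hq
    rw [map_neg, mul_neg]
    exact neg_mem (hq v)

/-- Membership in `H_a`. [folklore] -/
theorem mem_finiteAdeleSubgroup (a : FiniteAdeleRing ℤ ℚ) (q : ℚ) :
    q ∈ finiteAdeleSubgroup a ↔ ∀ v : HeightOneSpectrum ℤ,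
      a v * algebraMap ℚ (v.adicCompletion ℚ) q ∈ v.adicCompletionIntegers ℚ :=
  Iff.rfl

/-- `H_0 = ℚ` (the adèle `a = 0`). [folklore] -/
theorem finiteAdeleSubgroup_zero : finiteAdeleSubgroup 0 = ⊤ := by
  ext q
  simp only [mem_finiteAdeleSubgroup, AddSubgroup.mem_top, iff_true]
  intro v
  have : (0 : FiniteAdeleRing ℤ ℚ) v = 0 := rfl
  rw [this, zero_mul]
  exact zero_mem _

/-- `u ∈ Ẑ* ⊂ (𝔸^f)*`: a unit of the finite adèle ring which is integral at every place together
with its inverse (the maximal compact subgroup `Ẑ* = ∏ ℤ_p*`). [cite: ConnesConsani2016ArithmeticSite, §2.4] -/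
def IsZhatUnit (u : (FiniteAdeleRing ℤ ℚ)ˣ) : Prop :=
  ∀ v : HeightOneSpectrum ℤ,
    (u : FiniteAdeleRing ℤ ℚ) v ∈ v.adicCompletionIntegers ℚ ∧
      (↑u⁻¹ : FiniteAdeleRing ℤ ℚ) v ∈ v.adicCompletionIntegers ℚ

/-- **Connes–Consani 2016, Proposition 2.5 (i).** "Any non-trivial subgroup of `ℚ` is uniquely of
the form `H_a := {q ∈ ℚ | aq ∈ Ẑ}`, `a ∈ 𝔸^f/Ẑ*`, where `Ẑ*` denotes the multiplicative group of
invertible elements in the ring `Ẑ` acting by multiplication on `𝔸^f`": existence of `a` for every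
`H ≠ 0`, and `H_a = H_b ⇔ b ∈ Ẑ* a`. (Part (ii) — `a ↦ H_a` induces a bijection of
`ℚ₊^× \ 𝔸^f/Ẑ*` with the isomorphism classes of points of `ℕ̂^×` — follows with Thm. 2.1, Lemma
2.3 and `H_{qa} = q⁻¹H_a`.) [cite: ConnesConsani2016ArithmeticSite, Prop. 2.5 (i)] -/
def ConnesConsani2016_prop_2_5 : Prop :=
  (∀ H : AddSubgroup ℚ, H ≠ ⊥ → ∃ a : FiniteAdeleRing ℤ ℚ, finiteAdeleSubgroup a = H) ∧
    ∀ a b : FiniteAdeleRing ℤ ℚ,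
      finiteAdeleSubgroup a = finiteAdeleSubgroup b ↔
        ∃ u : (FiniteAdeleRing ℤ ℚ)ˣ, IsZhatUnit u ∧ b = (u : FiniteAdeleRing ℤ ℚ) * a

/-! ## Stalks `H_max` and points over `ℝ₊^max` (Thm. 3.2, Def. 3.6, Lemma 3.7, Thm. 3.8) -/

/-- A **point of the arithmetic site over `ℝ₊^max` sitting over the point `H` of `ℕ̂^×`**
(Definition 3.6 combined with Theorem 3.2: the stalk of `𝒪 = ℤ_max` at `H` is
`H_max = (H ∪ {-∞}, max, +)`): a morphism of semirings `f^# : H_max → ℝ_max = (ℝ ∪ {-∞}, max, +)`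
(written additively; `ℝ_max ≅ ℝ₊^max` by `exp`, §1.1), i.e. a map `WithBot H → WithBot ℝ` sending
`-∞ ↦ -∞`, `0 ↦ 0`, `max ↦ max`, `+ ↦ +`. [cite: ConnesConsani2016ArithmeticSite, Def. 3.6 with Thm. 3.2] -/
structure MaxPlusHom (H : AddSubgroup ℚ) where
  /-- the underlying map on the stalk `H_max = WithBot H` -/
  toFun : WithBot H → WithBot ℝ
  /-- the zero `-∞` of the semiring is preserved -/
  map_bot : toFun ⊥ = ⊥
  /-- the unit `0` of the semiring is preserved -/
  map_zero : toFun ((0 : H) : WithBot H) = ((0 : ℝ) : WithBot ℝ)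
  /-- the addition `max` is preserved -/
  map_sup : ∀ x y : WithBot H, toFun (x ⊔ y) = toFun x ⊔ toFun y
  /-- the multiplication `+` is preserved -/
  map_add : ∀ x y : WithBot H, toFun (x + y) = toFun x + toFun y

/-- The point over `ℝ₊^max` above `H` given by a scale `λ ≥ 0`: `h ↦ λh` (`-∞ ↦ -∞`). For `λ = 0`
this is the degenerate morphism `ι_p` with range `𝔹` (Thm. 3.8, case (α)); for `λ > 0` its range is
the rank-one subgroup `λH ⊂ ℝ` (case (β), eq. (21)). [cite: ConnesConsani2016ArithmeticSite, Thm. 3.8 proof, (α)–(β)] -/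
def MaxPlusHom.scale (H : AddSubgroup ℚ) (l : ℝ) (hl : 0 ≤ l) : MaxPlusHom H where
  toFun := WithBot.map fun h : H => l * ((h : ℚ) : ℝ)
  map_bot := rfl
  map_zero := by simp
  map_sup x y := by
    have hmono : Monotone fun h : H => l * ((h : ℚ) : ℝ) := by
      intro a b hab
      exact mul_le_mul_of_nonneg_left (by exact_mod_cast hab) hl
    induction x using WithBot.recBotCoe with
    | bot => simp
    | coe a =>
      induction y using WithBot.recBotCoe with
      | bot => simp
      | coe b =>
        simp only [← WithBot.coe_sup, WithBot.map_coe]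
        congr 1
        exact hmono.map_max
  map_add x y := by
    induction x using WithBot.recBotCoe with
    | bot => simp
    | coe a =>
      induction y using WithBot.recBotCoe with
      | bot => simp
      | coe b =>
        simp only [← WithBot.coe_add, WithBot.map_coe]
        congr 1
        push_cast
        ring

/-- **Connes–Consani 2016, Theorem 3.8 (classification of the stalk morphisms, proof cases
(α)/(β)).** Every morphism of semirings `H_max → ℝ_max` over a point `H ≠ 0` of `ℕ̂^×` is `h ↦ λh` for
a unique `λ ≥ 0`: either `λ = 0` ("the range of `f_p^#` is the semifield `𝔹 ⊂ ℝ₊^max` … this map is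
completely determined", the points FIXED by the Frobenius `Fr_μ`) or `λ > 0` ("`f_p^#` is an
isomorphism of the semifield `K` with a sub-semifield of `ℝ₊^max` … entirely determined by the
non-trivial rank one subgroup `H' = {log u | u ∈ f_p^#(K), u ≠ 0}`" `= λH`, on which `Fr_μ` acts by
`H' ↦ μH'`). Together with Prop. 2.5 and Lemma 3.7 this is the theorem's bijection of the points of
`𝒜` over `ℝ₊^max` with `ℚ^× \ 𝔸_ℚ/(Ẑ* × 1) = (ℚ₊^× \ 𝔸^f/Ẑ*) ⊔ ℚ₊^× \ (𝔸^f × ℝ₊*)/(Ẑ* × 1)`,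
the Frobenius `Fr_μ` corresponding to the idèle class `(1, μ) ∈ Ẑ* × ℝ₊* = C_ℚ`.
[cite: ConnesConsani2016ArithmeticSite, Thm. 3.8 (proof, cases (α), (β))] -/
def ConnesConsani2016_thm_3_8_stalkHom : Prop :=
  ∀ (H : AddSubgroup ℚ), H ≠ ⊥ → ∀ φ : MaxPlusHom H,
    ∃! l : ℝ, 0 ≤ l ∧ ∀ h : H, φ.toFun (h : WithBot H) = ((l * ((h : ℚ) : ℝ) : ℝ) : WithBot ℝ)

/-- `Φ(a, λ) := λH_a ⊂ ℝ` (Lemma 3.7), the rank-one subgroup of `ℝ` labelling the non-degenerate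
point `(H_a, h ↦ λh)` of `𝒜` over `ℝ₊^max`. [cite: ConnesConsani2016ArithmeticSite, Lemma 3.7] -/
def realScaledSubgroup (a : FiniteAdeleRing ℤ ℚ) (l : ℝ) : AddSubgroup ℝ where
  carrier := {x : ℝ | ∃ q ∈ finiteAdeleSubgroup a, x = l * (q : ℝ)}
  zero_mem' := ⟨0, zero_mem _, by simp⟩
  add_mem' := by
    rintro x y ⟨q, hq, rfl⟩ ⟨q', hq', rfl⟩
    exact ⟨q + q', add_mem hq hq', by push_cast; ring⟩
  neg_mem' := by
    rintro x ⟨q, hq, rfl⟩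
    exact ⟨-q, neg_mem hq, by push_cast; ring⟩

/-- A non-zero subgroup of `ℝ` "whose elements are pairwise commensurable" (Lemma 3.7): any two
elements have a rational ratio. Such a group is, as an ordered group, isomorphic to a subgroup of
`ℚ` (proof of Lemma 3.7). [cite: ConnesConsani2016ArithmeticSite, Lemma 3.7] -/
def IsCommensurableSubgroup (G : AddSubgroup ℝ) : Prop :=
  G ≠ ⊥ ∧ ∀ x ∈ G, ∀ y ∈ G, y ≠ 0 → ∃ r : ℚ, x = (r : ℝ) * y

/-- **Connes–Consani 2016, Lemma 3.7.** "`Φ` is a bijection between the quotient of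
`(𝔸^f/Ẑ*) × ℝ₊*` by the diagonal action of `ℚ₊^×` and the set of non zero subgroups of `ℝ` whose
elements are pairwise commensurable": `Φ(a, λ) = λH_a` is such a subgroup for `λ > 0`; every such
subgroup is a `Φ(a, λ)`; and `Φ(a, λ) = Φ(b, λ')` iff `λ' = qλ` and `b ∈ Ẑ* · qa` for some
`q ∈ ℚ₊^×` (the source: "Thus we get `λ' = qλ` and `b = qa`" in `𝔸^f/Ẑ*`). The Frobenius acts by
`Fr_u(Φ(a, λ)) = Φ(a, uλ)`. [cite: ConnesConsani2016ArithmeticSite, Lemma 3.7] -/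
def ConnesConsani2016_lemma_3_7 : Prop :=
  (∀ (a : FiniteAdeleRing ℤ ℚ) (l : ℝ), 0 < l → IsCommensurableSubgroup (realScaledSubgroup a l)) ∧
  (∀ G : AddSubgroup ℝ, IsCommensurableSubgroup G →
      ∃ (a : FiniteAdeleRing ℤ ℚ) (l : ℝ), 0 < l ∧ realScaledSubgroup a l = G) ∧
  ∀ (a b : FiniteAdeleRing ℤ ℚ) (l l' : ℝ), 0 < l → 0 < l' →
    (realScaledSubgroup a l = realScaledSubgroup b l' ↔
      ∃ q : ℚ, 0 < q ∧ l' = (q : ℝ) * l ∧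
        ∃ u : (FiniteAdeleRing ℤ ℚ)ˣ, IsZhatUnit u ∧
          b = (u : FiniteAdeleRing ℤ ℚ) * (algebraMap ℚ (FiniteAdeleRing ℤ ℚ) q * a))


/-! ## Discharge: the classification of stalk morphisms (Theorem 3.8, cases (α)/(β)) -/

/-- **Proof of `ConnesConsani2016_thm_3_8_stalkHom`** (the elementary heart of Thm. 3.8): a map
`H_max → ℝ_max` preserving `-∞`, `0`, `max` and `+` takes real values on `H` (since
`φ(h) + φ(-h) = φ(0) = 0`), is additive and monotone there, hence — `H ⊂ ℚ` being of rank one,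
`n h = m x₀` for suitable integers — is `h ↦ λh` with `λ = φ(x₀)/x₀ ≥ 0` for any `x₀ > 0` in `H`;
uniqueness from `x₀ ≠ 0`. [cite: ConnesConsani2016ArithmeticSite, Thm. 3.8 (proof, cases (α), (β))] -/
theorem ConnesConsani2016_thm_3_8_stalkHom_holds : ConnesConsani2016_thm_3_8_stalkHom := by
  intro H hH φ
  -- values on `H` are finite
  have hne : ∀ h : H, φ.toFun (h : WithBot H) ≠ ⊥ := by
    intro h hbot
    have h0 := φ.map_zero
    have : ((0 : H) : WithBot H) = (h : WithBot H) + ((-h : H) : WithBot H) := by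
      rw [← WithBot.coe_add, add_neg_cancel]
    rw [this, φ.map_add, hbot, WithBot.bot_add] at h0
    exact WithBot.bot_ne_coe h0
  set f : H → ℝ := fun h => (φ.toFun h).unbot (hne h) with hf
  have hcoe : ∀ h : H, φ.toFun (h : WithBot H) = ((f h : ℝ) : WithBot ℝ) := fun h =>
    (WithBot.coe_unbot _ (hne h)).symm
  have hadd : ∀ a b : H, f (a + b) = f a + f b := by
    intro a b
    have h1 : φ.toFun (((a + b : H)) : WithBot H) =
        φ.toFun (a : WithBot H) + φ.toFun (b : WithBot H) := by
      rw [WithBot.coe_add]; exact φ.map_add _ _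
    rw [hcoe, hcoe, hcoe, ← WithBot.coe_add] at h1
    exact_mod_cast h1
  have hmono : ∀ a b : H, a ≤ b → f a ≤ f b := by
    intro a b hab
    have h1 : φ.toFun ((a : WithBot H) ⊔ (b : WithBot H)) =
        φ.toFun (a : WithBot H) ⊔ φ.toFun (b : WithBot H) := φ.map_sup _ _
    have h2 : (a : WithBot H) ⊔ (b : WithBot H) = (b : WithBot H) :=
      sup_of_le_right (WithBot.coe_le_coe.mpr hab)
    rw [h2, hcoe, hcoe, ← WithBot.coe_sup] at h1
    have h3 : f b = f a ⊔ f b := by exact_mod_cast h1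
    rw [h3]
    exact le_sup_left
  have hzero : f 0 = 0 := by
    have h1 := φ.map_zero
    rw [hcoe] at h1
    exact_mod_cast h1
  let F : H →+ ℝ := { toFun := f, map_zero' := hzero, map_add' := hadd }
  have hF : ∀ h : H, F h = f h := fun _ => rfl
  -- a positive element of `H`
  obtain ⟨x, hxH, hx0⟩ : ∃ x ∈ H, x ≠ 0 := by
    by_contra hcon
    push Not at hcon
    exact hH ((AddSubgroup.eq_bot_iff_forall _).mpr hcon)
  obtain ⟨x₀, hx₀H, hx₀pos⟩ : ∃ x ∈ H, (0 : ℚ) < x := by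
    rcases lt_or_gt_of_ne hx0 with hneg | hpos
    · exact ⟨-x, H.neg_mem hxH, by linarith⟩
    · exact ⟨x, hxH, hpos⟩
  set e₀ : H := ⟨x₀, hx₀H⟩ with he₀
  have hx₀R : ((x₀ : ℚ) : ℝ) ≠ 0 := by exact_mod_cast hx₀pos.ne'
  -- linearity over the rank-one group `H`
  have hlin : ∀ h : H, f h = f e₀ / ((x₀ : ℚ) : ℝ) * ((h : ℚ) : ℝ) := by
    intro h
    set r : ℚ := (h : ℚ) / x₀ with hr
    have hhr : (h : ℚ) = r * x₀ := by rw [hr]; field_simp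
    have key : (r.den : ℤ) • h = r.num • e₀ := by
      apply Subtype.ext
      show (((r.den : ℤ) • h : H) : ℚ) = ((r.num • e₀ : H) : ℚ)
      rw [AddSubgroupClass.coe_zsmul, AddSubgroupClass.coe_zsmul, zsmul_eq_mul, zsmul_eq_mul]
      show ((r.den : ℤ) : ℚ) * (h : ℚ) = (r.num : ℚ) * x₀
      rw [hhr]
      calc ((r.den : ℤ) : ℚ) * (r * x₀) = (r * r.den) * x₀ := by push_cast; ring
        _ = r.num * x₀ := by rw [Rat.mul_den_eq_num]
    have hFkey : F ((r.den : ℤ) • h) = F (r.num • e₀) := by rw [key]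
    rw [map_zsmul, map_zsmul, hF, hF, zsmul_eq_mul, zsmul_eq_mul] at hFkey
    have hdenR : ((r.den : ℤ) : ℝ) ≠ 0 := by exact_mod_cast r.den_ne_zero
    have hhrR : ((h : ℚ) : ℝ) = (r : ℝ) * ((x₀ : ℚ) : ℝ) := by exact_mod_cast hhr
    rw [hhrR, Rat.cast_def r]
    field_simp
    have : ((r.den : ℤ) : ℝ) = ((r.den : ℕ) : ℝ) := by norm_cast
    rw [this] at hFkey
    linear_combination hFkey
  refine ⟨f e₀ / ((x₀ : ℚ) : ℝ), ⟨?_, fun h => by rw [hcoe, hlin h]⟩, ?_⟩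
  · have h1 : f 0 ≤ f e₀ := hmono 0 e₀ (show ((0 : H) : ℚ) ≤ (e₀ : ℚ) from hx₀pos.le)
    rw [hzero] at h1
    exact div_nonneg h1 (by exact_mod_cast hx₀pos.le)
  · rintro l ⟨-, hl⟩
    have h1 := hl e₀
    rw [hcoe, hlin e₀] at h1
    have h2 : f e₀ / ((x₀ : ℚ) : ℝ) * ((x₀ : ℚ) : ℝ) = l * ((x₀ : ℚ) : ℝ) := by exact_mod_cast h1
    exact (mul_right_cancel₀ hx₀R h2).symm


/-! ## Discharge: Theorem 2.1 (objects) — every point of `ℕ̂^×` is `H_{>0}` (Lemmas 2.2–2.3) -/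

namespace IsToposPoint

variable {X : Type u} [MulAction ℕ+ X] (hX : IsToposPoint X)

/-- A base point of a point of `ℕ̂^×` (choice). [folklore] -/
def base : X := Classical.choice hX.nonempty

/-- The ratio `j_{x₀}(x) = k'/k` for `kz = x₀`, `k'z = x` (Lemma 2.3: "`j_x(x') := k'/k`"), defined
through a chosen common divisor. [cite: ConnesConsani2016ArithmeticSite, Lemma 2.3] -/
def ratio (x : X) : ℚ :=
  ((Classical.choose (Classical.choose_spec (Classical.choose_spec (hX.directed hX.base x))) : ℕ+) : ℚ) /
    ((Classical.choose (Classical.choose_spec (hX.directed hX.base x)) : ℕ+) : ℚ)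

include hX in
/-- Well-definedness of the ratio (proof of Lemma 2.2/2.3: "another choice `y, ℓ, ℓ'` of `z, k, k'`
gives the equalities `aℓ = bk`, `aℓ' = bk'` showing that `k'/k = ℓ'/ℓ`"). [cite: ConnesConsani2016ArithmeticSite, Lemmas 2.2–2.3] -/
theorem ratio_wd {x z y : X} {k k' l l' : ℕ+} (hz : k • z = hX.base) (hz' : k' • z = x)
    (hy : l • y = hX.base) (hy' : l' • y = x) : ((k' : ℕ+) : ℚ) / k = ((l' : ℕ+) : ℚ) / l := by
  obtain ⟨u, a, b, hau, hbu⟩ := hX.directed z y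
  have h1 : (k * a) • u = (l * b) • u := by
    rw [← smul_smul, ← smul_smul, hau, hbu, hz, hy]
  have h2 : (k' * a) • u = (l' * b) • u := by
    rw [← smul_smul, ← smul_smul, hau, hbu, hz', hy']
  have e1 := hX.separated u _ _ h1
  have e2 := hX.separated u _ _ h2
  have e1' : ((k : ℕ+) : ℚ) * a = (l : ℚ) * b := by exact_mod_cast congrArg (fun t : ℕ+ => ((t : ℕ) : ℚ)) e1
  have e2' : ((k' : ℕ+) : ℚ) * a = (l' : ℚ) * b := by exact_mod_cast congrArg (fun t : ℕ+ => ((t : ℕ) : ℚ)) e2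
  have ha : ((a : ℕ+) : ℚ) ≠ 0 := by exact_mod_cast a.ne_zero
  have hb : ((b : ℕ+) : ℚ) ≠ 0 := by exact_mod_cast b.ne_zero
  rw [← mul_div_mul_right (k' : ℚ) k ha, e1', e2', mul_div_mul_right _ _ hb]

/-- The ratio computed from ANY common divisor: `j(x) = k'/k` whenever `kz = x₀`, `k'z = x`.
[cite: ConnesConsani2016ArithmeticSite, Lemma 2.3] -/
theorem ratio_eq {x z : X} {k k' : ℕ+} (hz : k • z = hX.base) (hz' : k' • z = x) :
    hX.ratio x = ((k' : ℕ+) : ℚ) / k := by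
  have h1 := Classical.choose_spec (Classical.choose_spec (Classical.choose_spec (hX.directed hX.base x)))
  exact hX.ratio_wd h1.1 h1.2 hz hz'

/-- `j(x) > 0`. [folklore] -/
theorem ratio_pos (x : X) : 0 < hX.ratio x := by
  obtain ⟨z, k, k', hz, hz'⟩ := hX.directed hX.base x
  rw [hX.ratio_eq hz hz']
  exact div_pos (by exact_mod_cast k'.pos) (by exact_mod_cast k.pos)

/-- `j(x₀) = 1` (Lemma 2.3: "`j_x(x) = 1`"). [cite: ConnesConsani2016ArithmeticSite, Lemma 2.3] -/
theorem ratio_base : hX.ratio hX.base = 1 := by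
  rw [hX.ratio_eq (z := hX.base) (k := 1) (k' := 1) (one_smul _ _) (one_smul _ _)]
  simp

/-- Equivariance `j(nx) = n j(x)` (Lemma 2.2: "`kx = x + ⋯ + x`"). [cite: ConnesConsani2016ArithmeticSite, Lemma 2.2] -/
theorem ratio_smul (n : ℕ+) (x : X) : hX.ratio (n • x) = (n : ℕ) * hX.ratio x := by
  obtain ⟨z, k, k', hz, hz'⟩ := hX.directed hX.base x
  have hz'' : (n * k') • z = n • x := by rw [← smul_smul, hz']
  rw [hX.ratio_eq hz hz', hX.ratio_eq hz hz'']
  push_cast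
  ring

/-- Two elements over a common divisor (filtering condition (ii)), with their ratios. [folklore] -/
theorem exists_common (x y : X) :
    ∃ (w : X) (m n : ℕ+), m • w = x ∧ n • w = y ∧
      hX.ratio x = (m : ℕ) * hX.ratio w ∧ hX.ratio y = (n : ℕ) * hX.ratio w := by
  obtain ⟨w, m, n, hm, hn⟩ := hX.directed x y
  exact ⟨w, m, n, hm, hn, by rw [← hm, hX.ratio_smul], by rw [← hn, hX.ratio_smul]⟩

/-- `j` is injective (a natural transformation of flat functors is injective, proof of Thm. 2.1).
[cite: ConnesConsani2016ArithmeticSite, Thm. 2.1 (proof)] -/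
theorem ratio_injective : Function.Injective hX.ratio := by
  intro x y hxy
  obtain ⟨w, m, n, hm, hn, hx, hy⟩ := hX.exists_common x y
  rw [hx, hy] at hxy
  have hw : hX.ratio w ≠ 0 := (hX.ratio_pos w).ne'
  have : ((m : ℕ) : ℚ) = (n : ℕ) := mul_right_cancel₀ hw hxy
  have hmn : m = n := PNat.coe_injective (by exact_mod_cast this)
  rw [← hm, ← hn, hmn]

/-- The rank-one group `H` generated by the ratios: `{0} ∪ j(X) ∪ -j(X)` (Lemma 2.2: the
symmetrization of the semigroup `(X,+)`). [cite: ConnesConsani2016ArithmeticSite, Lemma 2.2] -/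
def group : AddSubgroup ℚ where
  carrier := {q : ℚ | q = 0 ∨ (∃ x : X, q = hX.ratio x) ∨ ∃ x : X, q = -hX.ratio x}
  zero_mem' := Or.inl rfl
  add_mem' := by
    rintro q q' hq hq'
    rcases hq with rfl | ⟨x, rfl⟩ | ⟨x, rfl⟩
    · simpa using hq'
    · rcases hq' with rfl | ⟨y, rfl⟩ | ⟨y, rfl⟩
      · simp
      · obtain ⟨w, m, n, -, -, hx, hy⟩ := hX.exists_common x y
        right; left
        refine ⟨(m + n) • w, ?_⟩
        rw [hx, hy, hX.ratio_smul]; push_cast; ring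
      · obtain ⟨w, m, n, -, -, hx, hy⟩ := hX.exists_common x y
        rw [hx, hy]
        rcases lt_trichotomy (m : ℕ) (n : ℕ) with hlt | heq | hgt
        · right; right
          have hlt' : m < n := hlt
          refine ⟨(n - m) • w, ?_⟩
          rw [hX.ratio_smul, PNat.sub_coe, if_pos hlt']
          push_cast [Nat.cast_sub hlt.le]
          ring
        · left
          rw [heq]; ring
        · right; left
          have hgt' : n < m := hgt
          refine ⟨(m - n) • w, ?_⟩
          rw [hX.ratio_smul, PNat.sub_coe, if_pos hgt']
          push_cast [Nat.cast_sub hgt.le]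
          ring
    · rcases hq' with rfl | ⟨y, rfl⟩ | ⟨y, rfl⟩
      · simp
      · obtain ⟨w, m, n, -, -, hx, hy⟩ := hX.exists_common x y
        rw [hx, hy]
        rcases lt_trichotomy (m : ℕ) (n : ℕ) with hlt | heq | hgt
        · right; left
          have hlt' : m < n := hlt
          refine ⟨(n - m) • w, ?_⟩
          rw [hX.ratio_smul, PNat.sub_coe, if_pos hlt']
          push_cast [Nat.cast_sub hlt.le]
          ring
        · left
          rw [heq]; ring
        · right; right
          have hgt' : n < m := hgt
          refine ⟨(m - n) • w, ?_⟩
          rw [hX.ratio_smul, PNat.sub_coe, if_pos hgt']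
          push_cast [Nat.cast_sub hgt.le]
          ring
      · obtain ⟨w, m, n, -, -, hx, hy⟩ := hX.exists_common x y
        right; right
        refine ⟨(m + n) • w, ?_⟩
        rw [hx, hy, hX.ratio_smul]; push_cast; ring
  neg_mem' := by
    rintro q (rfl | ⟨x, rfl⟩ | ⟨x, rfl⟩)
    · simp
    · right; right; exact ⟨x, rfl⟩
    · right; left; exact ⟨x, by ring⟩

/-- `H_{>0} = j(X)` (Lemma 2.2: "One has `X = {h ∈ H ∣ h > 0}`"). [cite: ConnesConsani2016ArithmeticSite, Lemma 2.2] -/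
theorem mem_group_pos_iff (q : ℚ) : (q ∈ hX.group ∧ 0 < q) ↔ ∃ x : X, q = hX.ratio x := by
  constructor
  · rintro ⟨hq, hpos⟩
    rcases hq with rfl | ⟨x, rfl⟩ | ⟨x, rfl⟩
    · exact absurd hpos (lt_irrefl 0)
    · exact ⟨x, rfl⟩
    · exact absurd hpos (by have := hX.ratio_pos x; push Not; linarith)
  · rintro ⟨x, rfl⟩
    exact ⟨Or.inr (Or.inl ⟨x, rfl⟩), hX.ratio_pos x⟩

/-- `H ≠ 0` (it contains `j(x₀) = 1`). [folklore] -/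
theorem group_ne_bot : hX.group ≠ ⊥ := by
  intro h
  have h1 : hX.ratio hX.base ∈ hX.group := Or.inr (Or.inl ⟨hX.base, rfl⟩)
  rw [h, AddSubgroup.mem_bot, hX.ratio_base] at h1
  exact one_ne_zero h1

/-- The equivariant bijection `X ≃ H_{>0}` of Theorem 2.1 / Lemma 2.2.
[cite: ConnesConsani2016ArithmeticSite, Thm. 2.1 (Lemma 2.2)] -/
def equiv : X ≃ posCone hX.group where
  toFun x := ⟨hX.ratio x, (hX.mem_group_pos_iff _).mpr ⟨x, rfl⟩⟩
  invFun q := Classical.choose ((hX.mem_group_pos_iff q.1).mp q.2)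
  left_inv x := by
    have h := Classical.choose_spec ((hX.mem_group_pos_iff (hX.ratio x)).mp
      ((hX.mem_group_pos_iff _).mpr ⟨x, rfl⟩))
    exact (hX.ratio_injective h).symm
  right_inv q := by
    apply Subtype.ext
    exact (Classical.choose_spec ((hX.mem_group_pos_iff q.1).mp q.2)).symm

end IsToposPoint

/-- **Proof of `ConnesConsani2016_thm_2_1`** (Connes–Consani 2016, Thm. 2.1, objects), following
Lemmas 2.2–2.3 of the source: the ratios `j_{x₀}` embed the flat `ℕ^×`-set `X` equivariantly onto the
strictly positive part of the rank-one group `H = {0} ∪ j(X) ∪ -j(X) ⊂ ℚ`.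
[cite: ConnesConsani2016ArithmeticSite, Thm. 2.1 (Lemmas 2.2–2.3)] -/
theorem ConnesConsani2016_thm_2_1_holds : ConnesConsani2016_thm_2_1.{u} := by
  intro X _ hX
  refine ⟨hX.group, hX.group_ne_bot, hX.equiv, fun k x => ?_⟩
  show hX.ratio (k • x) = (k : ℕ) * hX.ratio x
  exact hX.ratio_smul k x



/-! ## Discharge of `ConnesConsani2016_prop_2_5` (appended 2026-08-19, cc-1 gen 2)

The source (Prop. 2.5 (i)) argues by Pontrjagin duality `Ẑ ≅ (ℚ/ℤ)^`: a closed subgroup `J ⊂ Ẑ`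
is an ideal, `J = ∏_p J_p` with `J_p = a_p ℤ_p` principal and `a_p` unique up to `ℤ_p^*`. Mathlib has
no Pontrjagin duality for `Ẑ`, so we prove the same place-by-place statement elementarily: at a
place `v` (prime `p_v`) the `v`-adic valuations of the elements of `H` are either bounded — then
`a_v := p_v^{k_v}` with `k_v` the largest exponent — or unbounded, `a_v := 0`; `H ⊆ H_a` is the
definition of `k_v`, and `H_a ⊆ H` because for `q ∈ H_a` the ideal `{s ∈ ℤ | sq ∈ H}` lies in no
maximal ideal `(p)` (some `h ∈ H` has `|q|_p ≤ |h|_p`, so the denominator of `q/h` is prime to `p`).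
Uniqueness up to `Ẑ^*`: `H_a` contains test elements `p_v^{-n} N` of prescribed `v`-valuation, which
force `|a_v|_v = |b_v|_v` (and `a_v = 0 ⇔ b_v = 0`) whenever `H_a = H_b`; then `u_v := b_v/a_v`
(`:= 1` where `a_v = 0`) is a unit at every place, i.e. `u ∈ Ẑ^*`, and `b = ua`.
-/

section Prop25

open IsDedekindDomain.HeightOneSpectrum WithZero

/-- Valuation form of the membership `q ∈ H_a`: `|a_v|_v · |q|_v ≤ 1` at every place. [folklore] -/
theorem mem_finiteAdeleSubgroup_iff_valuation (a : FiniteAdeleRing ℤ ℚ) (q : ℚ) :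
    q ∈ finiteAdeleSubgroup a ↔
      ∀ v : HeightOneSpectrum ℤ, Valued.v (a v) * v.valuation ℚ q ≤ 1 := by
  rw [mem_finiteAdeleSubgroup]
  refine forall_congr' fun v ↦ ?_
  rw [mem_adicCompletionIntegers, map_mul]
  have hval : Valued.v (algebraMap ℚ (v.adicCompletion ℚ) q) = v.valuation ℚ q :=
    valuedAdicCompletion_eq_valuation' v q
  rw [hval]

/-! ### The prime number under a place of `ℤ` -/

/-- The (positive) prime number generating the place `v` of `ℤ`. [folklore] -/
def placePrime (v : HeightOneSpectrum ℤ) : ℕ :=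
  (Submodule.IsPrincipal.generator v.asIdeal).natAbs

/-- `v = (p_v)`. [folklore] -/
theorem span_placePrime (v : HeightOneSpectrum ℤ) :
    v.asIdeal = Ideal.span {(placePrime v : ℤ)} := by
  rw [placePrime, Int.span_natAbs, Ideal.span_singleton_generator]

/-- `p_v` is a prime number. [folklore] -/
theorem placePrime_prime (v : HeightOneSpectrum ℤ) : (placePrime v).Prime := by
  have h := Submodule.IsPrincipal.prime_generator_of_isPrime v.asIdeal v.ne_bot
  exact Int.prime_iff_natAbs_prime.1 h

/-- `p_v ≠ 0` in `ℚ`. [folklore] -/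
theorem placePrime_ne_zero (v : HeightOneSpectrum ℤ) : (placePrime v : ℚ) ≠ 0 := by
  exact_mod_cast (placePrime_prime v).ne_zero

/-- The valuation of a natural number at `v` is its `intValuation`. [folklore] -/
theorem valuation_natCast (v : HeightOneSpectrum ℤ) (n : ℕ) :
    v.valuation ℚ (n : ℚ) = v.intValuation (n : ℤ) := by
  rw [← valuation_of_algebraMap (K := ℚ)]
  simp

/-- `|p_v|_v = exp(-1)` (a uniformizer). [folklore] -/
theorem valuation_placePrime_self (v : HeightOneSpectrum ℤ) :
    v.valuation ℚ (placePrime v : ℚ) = exp (-1 : ℤ) := by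
  rw [valuation_natCast]
  exact intValuation_singleton v (by exact_mod_cast (placePrime_prime v).ne_zero) (span_placePrime v)

/-- `|p_w|_v = 1` for `w ≠ v`. [folklore] -/
theorem valuation_placePrime_of_ne {v w : HeightOneSpectrum ℤ} (h : w ≠ v) :
    v.valuation ℚ (placePrime w : ℚ) = 1 := by
  rw [valuation_natCast, intValuation_eq_one_iff]
  intro hmem
  apply h
  rw [span_placePrime v, Ideal.mem_span_singleton, Int.natCast_dvd_natCast,
    Nat.prime_dvd_prime_iff_eq (placePrime_prime v) (placePrime_prime w)] at hmem
  ext1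
  rw [span_placePrime v, span_placePrime w, hmem]


/-! ### Test elements of `H_a` with prescribed valuation at one place -/

/-- Valuation at `w ∈ T` of a product of prime powers `∏_{w' ∈ T} p_{w'}^{m(w')}`. [folklore] -/
theorem valuation_prod_placePrime_pow_of_mem {T : Finset (HeightOneSpectrum ℤ)}
    (m : HeightOneSpectrum ℤ → ℕ) {w : HeightOneSpectrum ℤ} (hw : w ∈ T) :
    w.valuation ℚ ((∏ w' ∈ T, placePrime w' ^ m w' : ℕ) : ℚ) = exp (-(m w : ℤ)) := by
  push_cast
  rw [map_prod]
  simp_rw [map_pow]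
  rw [Finset.prod_eq_single w]
  · rw [valuation_placePrime_self, ← exp_nsmul, smul_neg, nsmul_eq_mul, mul_one]
  · intro w' _ hw'
    rw [valuation_placePrime_of_ne hw', one_pow]
  · intro h; exact absurd hw h

/-- Valuation at `w ∉ T` of a product of prime powers `∏_{w' ∈ T} p_{w'}^{m(w')}` is `1`.
[folklore] -/
theorem valuation_prod_placePrime_pow_of_not_mem {T : Finset (HeightOneSpectrum ℤ)}
    (m : HeightOneSpectrum ℤ → ℕ) {w : HeightOneSpectrum ℤ} (hw : w ∉ T) :
    w.valuation ℚ ((∏ w' ∈ T, placePrime w' ^ m w' : ℕ) : ℚ) = 1 := by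
  push_cast
  rw [map_prod]
  simp_rw [map_pow]
  refine Finset.prod_eq_one fun w' hw' ↦ ?_
  have : w' ≠ w := fun h ↦ hw (h ▸ hw')
  rw [valuation_placePrime_of_ne this, one_pow]

/-- A nonzero element of `ℤᵐ⁰` is `≤ exp` of the `toNat` of its `log`. [folklore] -/
private theorem le_exp_toNat_log (x : WithZero (Multiplicative ℤ)) :
    x ≤ exp ((log x).toNat : ℤ) := by
  rcases eq_or_ne x 0 with rfl | hx
  · exact zero_le
  · conv_lhs => rw [← exp_log hx]
    rw [exp_le_exp]
    exact Int.self_le_toNat _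

/-- **Test elements.** If `|a_v|_v e^{n} ≤ 1` then `H_a` contains a rational number `q` with
`|q|_v = e^{n}`, namely `q = p_v^{-n} ∏_{w ∈ S∖{v}} p_w^{m_w}` (`S` the finitely many places where `a`
is not integral, `m_w` large). [folklore] -/
theorem exists_mem_finiteAdeleSubgroup_valuation_eq (a : FiniteAdeleRing ℤ ℚ)
    (v : HeightOneSpectrum ℤ) (n : ℤ) (hn : Valued.v (a v) * exp n ≤ 1) :
    ∃ q ∈ finiteAdeleSubgroup a, v.valuation ℚ q = exp n := by
  classical
  have hS : {w : HeightOneSpectrum ℤ | a w ∉ w.adicCompletionIntegers ℚ}.Finite :=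
    Filter.eventually_cofinite.1 a.2
  set T : Finset (HeightOneSpectrum ℤ) := hS.toFinset.erase v with hT
  set m : HeightOneSpectrum ℤ → ℕ := fun w ↦ (log (Valued.v (a w))).toNat with hm
  set N : ℕ := ∏ w ∈ T, placePrime w ^ m w with hN
  have hvT : v ∉ T := by simp [hT]
  have hNv : v.valuation ℚ (N : ℚ) = 1 := by
    rw [hN, valuation_prod_placePrime_pow_of_not_mem m hvT]
  have hpv : v.valuation ℚ ((placePrime v : ℚ) ^ (-n)) = exp n := by
    rw [map_zpow₀, valuation_placePrime_self, ← exp_zsmul, smul_eq_mul]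
    congr 1
    ring
  refine ⟨(placePrime v : ℚ) ^ (-n) * (N : ℚ), ?_, by rw [map_mul, hpv, hNv, mul_one]⟩
  rw [mem_finiteAdeleSubgroup_iff_valuation]
  intro w
  by_cases hwv : w = v
  · subst hwv
    rwa [map_mul, hpv, hNv, mul_one]
  · have hpw : w.valuation ℚ ((placePrime v : ℚ) ^ (-n)) = 1 := by
      rw [map_zpow₀, valuation_placePrime_of_ne (fun h ↦ hwv h.symm), one_zpow]
    rw [map_mul, hpw, one_mul, hN]
    by_cases hwT : w ∈ T
    · rw [valuation_prod_placePrime_pow_of_mem m hwT]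
      calc Valued.v (a w) * exp (-(m w : ℤ))
          ≤ exp (m w : ℤ) * exp (-(m w : ℤ)) := mul_le_mul_left (le_exp_toNat_log _) _
        _ = 1 := by rw [← exp_add, add_neg_cancel, exp_zero]
    · have hint : a w ∈ w.adicCompletionIntegers ℚ := by
        by_contra hcon
        apply hwT
        rw [hT, Finset.mem_erase]
        exact ⟨hwv, hS.mem_toFinset.2 hcon⟩
      rw [valuation_prod_placePrime_pow_of_not_mem m hwT, mul_one]
      exact hint

/-- If `H_a ⊆ H_b` and `a_v ≠ 0` then `|b_v|_v ≤ |a_v|_v`. [folklore] -/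
theorem valued_le_of_finiteAdeleSubgroup_le {a b : FiniteAdeleRing ℤ ℚ}
    (hab : finiteAdeleSubgroup a ≤ finiteAdeleSubgroup b) {v : HeightOneSpectrum ℤ}
    (hav : a v ≠ 0) : Valued.v (b v) ≤ Valued.v (a v) := by
  have hav' : Valued.v (a v) ≠ 0 := (Valuation.ne_zero_iff _).2 hav
  set k : ℤ := log (Valued.v (a v)) with hk
  have hak : Valued.v (a v) = exp k := (exp_log hav').symm
  obtain ⟨q, hq, hvq⟩ := exists_mem_finiteAdeleSubgroup_valuation_eq a v (-k)
    (by rw [hak, ← exp_add, add_neg_cancel, exp_zero])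
  have hqb := (mem_finiteAdeleSubgroup_iff_valuation b q).1 (hab hq) v
  rw [hvq] at hqb
  rw [hak]
  calc Valued.v (b v) = Valued.v (b v) * exp (-k) * exp k := by
        rw [mul_assoc, ← exp_add, neg_add_cancel, exp_zero, mul_one]
    _ ≤ 1 * exp k := mul_le_mul_left hqb _
    _ = exp k := one_mul _

/-- If `H_a ⊆ H_b` and `a_v = 0` then `b_v = 0`. [folklore] -/
theorem eq_zero_of_finiteAdeleSubgroup_le {a b : FiniteAdeleRing ℤ ℚ}
    (hab : finiteAdeleSubgroup a ≤ finiteAdeleSubgroup b) {v : HeightOneSpectrum ℤ}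
    (hav : a v = 0) : b v = 0 := by
  by_contra hbv
  have hbv' : Valued.v (b v) ≠ 0 := (Valuation.ne_zero_iff _).2 hbv
  set k : ℤ := log (Valued.v (b v)) with hk
  have hbk : Valued.v (b v) = exp k := (exp_log hbv').symm
  obtain ⟨q, hq, hvq⟩ := exists_mem_finiteAdeleSubgroup_valuation_eq a v (1 - k)
    (by rw [hav, map_zero, zero_mul]; exact zero_le)
  have hqb := (mem_finiteAdeleSubgroup_iff_valuation b q).1 (hab hq) v
  rw [hvq, hbk, ← exp_add, ← exp_zero, exp_le_exp] at hqb
  omega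


/-! ### Uniqueness up to `Ẑ^*` -/

/-- Multiplication in `𝔸^f` is componentwise. [folklore] -/
private theorem finiteAdele_mul_apply (x y : FiniteAdeleRing ℤ ℚ) (v : HeightOneSpectrum ℤ) :
    (x * y) v = x v * y v := rfl

/-- The unit of `𝔸^f` is componentwise `1`. [folklore] -/
private theorem finiteAdele_one_apply (v : HeightOneSpectrum ℤ) :
    (1 : FiniteAdeleRing ℤ ℚ) v = 1 := rfl

/-- A `Ẑ^*`-unit has valuation `1` at every place. [folklore] -/
theorem IsZhatUnit.valued_eq_one {u : (FiniteAdeleRing ℤ ℚ)ˣ} (hu : IsZhatUnit u)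
    (v : HeightOneSpectrum ℤ) : Valued.v ((u : FiniteAdeleRing ℤ ℚ) v) = 1 := by
  obtain ⟨hu1, hu2⟩ := hu v
  rw [mem_adicCompletionIntegers] at hu1 hu2
  have hprod : (↑u⁻¹ : FiniteAdeleRing ℤ ℚ) v * (u : FiniteAdeleRing ℤ ℚ) v = 1 := by
    have := congrArg (fun x : FiniteAdeleRing ℤ ℚ ↦ x v) u.inv_mul
    simpa only [finiteAdele_mul_apply, finiteAdele_one_apply] using this
  have h := congrArg Valued.v hprod
  rw [map_mul, map_one] at h
  refine le_antisymm hu1 ?_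
  calc (1 : WithZero (Multiplicative ℤ)) = _ := h.symm
    _ ≤ 1 * Valued.v ((u : FiniteAdeleRing ℤ ℚ) v) := mul_le_mul_left hu2 _
    _ = _ := one_mul _

/-- **Prop. 2.5 (i), uniqueness:** `H_a = H_b ⇔ b ∈ Ẑ^* a`. [cite: ConnesConsani2016ArithmeticSite, Prop. 2.5 (i)] -/
theorem finiteAdeleSubgroup_eq_iff (a b : FiniteAdeleRing ℤ ℚ) :
    finiteAdeleSubgroup a = finiteAdeleSubgroup b ↔
      ∃ u : (FiniteAdeleRing ℤ ℚ)ˣ, IsZhatUnit u ∧ b = (u : FiniteAdeleRing ℤ ℚ) * a := by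
  classical
  constructor
  · intro hab
    have hle : finiteAdeleSubgroup a ≤ finiteAdeleSubgroup b := hab.le
    have hge : finiteAdeleSubgroup b ≤ finiteAdeleSubgroup a := hab.ge
    have hzero : ∀ v, a v = 0 ↔ b v = 0 := fun v ↦
      ⟨eq_zero_of_finiteAdeleSubgroup_le hle, eq_zero_of_finiteAdeleSubgroup_le hge⟩
    have hval : ∀ v, a v ≠ 0 → Valued.v (b v) = Valued.v (a v) := fun v hav ↦
      le_antisymm (valued_le_of_finiteAdeleSubgroup_le hle hav)
        (valued_le_of_finiteAdeleSubgroup_le hge fun h ↦ hav ((hzero v).2 h))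
    -- the unit, componentwise
    set uf : (v : HeightOneSpectrum ℤ) → v.adicCompletion ℚ :=
      fun v ↦ if a v = 0 then 1 else b v / a v with huf
    have huval : ∀ v, Valued.v (uf v) = 1 := by
      intro v
      simp only [huf]
      split_ifs with h
      · exact map_one _
      · rw [map_div₀, hval v h, div_self ((Valuation.ne_zero_iff _).2 h)]
    have hufint : ∀ v, uf v ∈ v.adicCompletionIntegers ℚ := fun v ↦ by
      rw [mem_adicCompletionIntegers, huval]
    set u0 : FiniteAdeleRing ℤ ℚ := ⟨uf, Filter.Eventually.of_forall fun v ↦ hufint v⟩ with hu0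
    have hu0v : ∀ v, u0 v = uf v := fun v ↦ rfl
    have hunit : IsUnit u0 := by
      rw [FiniteAdeleRing.isUnit_iff]
      refine ⟨fun v h0 ↦ ?_, Filter.Eventually.of_forall fun v ↦ by rw [hu0v, huval]⟩
      have := huval v
      rw [← hu0v, h0, map_zero] at this
      exact zero_ne_one this
    refine ⟨hunit.unit, fun v ↦ ⟨?_, ?_⟩, ?_⟩
    · rw [hunit.unit_spec, hu0v]
      exact hufint v
    · have hinv : (↑hunit.unit⁻¹ : FiniteAdeleRing ℤ ℚ) v * u0 v = 1 := by
        have h := congrArg (fun x : FiniteAdeleRing ℤ ℚ ↦ x v) hunit.unit.inv_mul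
        simpa only [finiteAdele_mul_apply, finiteAdele_one_apply, hunit.unit_spec] using h
      have h1 : Valued.v ((↑hunit.unit⁻¹ : FiniteAdeleRing ℤ ℚ) v) * Valued.v (u0 v) = 1 := by
        rw [← map_mul, hinv, map_one]
      rw [hu0v, huval, mul_one] at h1
      rw [mem_adicCompletionIntegers]
      exact h1.le
    · apply FiniteAdeleRing.ext
      intro v
      rw [finiteAdele_mul_apply, hunit.unit_spec, hu0v]
      simp only [huf]
      split_ifs with h
      · rw [h, (hzero v).1 h, mul_zero]
      · rw [div_mul_cancel₀ _ h]
  · rintro ⟨u, hu, rfl⟩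
    ext q
    rw [mem_finiteAdeleSubgroup_iff_valuation, mem_finiteAdeleSubgroup_iff_valuation]
    refine forall_congr' fun v ↦ ?_
    rw [finiteAdele_mul_apply, map_mul, hu.valued_eq_one v, one_mul]

/-! ### Existence: every non-trivial `H ⊂ ℚ` is an `H_a` -/

/-- **Prop. 2.5 (i), existence:** every non-trivial subgroup of `ℚ` is `H_a` for a finite adèle `a`
(`a_v = p_v^{k_v}`, `k_v` the largest `v`-adic exponent occurring in `H`, or `a_v = 0` if these are
unbounded). [cite: ConnesConsani2016ArithmeticSite, Prop. 2.5 (i)] -/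
theorem exists_finiteAdeleSubgroup_eq (H : AddSubgroup ℚ) (hH : H ≠ ⊥) :
    ∃ a : FiniteAdeleRing ℤ ℚ, finiteAdeleSubgroup a = H := by
  classical
  obtain ⟨h₀, hh₀H, hh₀⟩ : ∃ h ∈ H, h ≠ 0 := by
    by_contra hcon
    push Not at hcon
    exact hH ((AddSubgroup.eq_bot_iff_forall _).mpr hcon)
  -- the exponents of `H` at `v`
  set L : HeightOneSpectrum ℤ → Set ℤ := fun v ↦
    {k | ∃ h ∈ H, h ≠ 0 ∧ log (v.valuation ℚ h) = k} with hL
  have hLne : ∀ v, (L v).Nonempty := fun v ↦ ⟨_, h₀, hh₀H, hh₀, rfl⟩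
  -- the components of `a`
  set af : (v : HeightOneSpectrum ℤ) → v.adicCompletion ℚ := fun v ↦
    if BddAbove (L v) then algebraMap ℚ (v.adicCompletion ℚ) ((placePrime v : ℚ) ^ (sSup (L v)))
    else 0 with haf
  have hafval : ∀ v, BddAbove (L v) → Valued.v (af v) = exp (-(sSup (L v))) := by
    intro v hb
    simp only [haf, if_pos hb]
    have hval : Valued.v (algebraMap ℚ (v.adicCompletion ℚ) ((placePrime v : ℚ) ^ (sSup (L v)))) =
        v.valuation ℚ ((placePrime v : ℚ) ^ (sSup (L v))) :=
      valuedAdicCompletion_eq_valuation' v _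
    rw [hval, map_zpow₀, valuation_placePrime_self, ← exp_zsmul, smul_eq_mul, mul_neg, mul_one]
  have hafzero : ∀ v, ¬ BddAbove (L v) → af v = 0 := fun v hb ↦ by simp only [haf, if_neg hb]
  -- `h₀` is a unit at almost every place, so `a_v` is integral there
  have hlog0 : ∀ᶠ v : HeightOneSpectrum ℤ in Filter.cofinite, 0 ≤ log (v.valuation ℚ h₀) := by
    rw [Filter.eventually_cofinite]
    refine (HeightOneSpectrum.Support.finite ℤ (h₀⁻¹ : ℚ)).subset fun v hv ↦ ?_
    simp only [Set.mem_setOf_eq, not_le] at hv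
    show 1 < v.valuation ℚ h₀⁻¹
    have hne : v.valuation ℚ h₀ ≠ 0 := (Valuation.ne_zero_iff _).2 hh₀
    rw [map_inv₀, ← exp_log hne, ← exp_neg, ← exp_zero, exp_lt_exp]
    omega
  have hfin : ∀ᶠ v : HeightOneSpectrum ℤ in Filter.cofinite,
      af v ∈ (v.adicCompletionIntegers ℚ : Set (v.adicCompletion ℚ)) := by
    filter_upwards [hlog0] with v hv
    rw [SetLike.mem_coe]
    by_cases hb : BddAbove (L v)
    · rw [mem_adicCompletionIntegers, hafval v hb, ← exp_zero, exp_le_exp, neg_nonpos]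
      exact hv.trans (le_csSup hb ⟨h₀, hh₀H, hh₀, rfl⟩)
    · rw [hafzero v hb]
      exact zero_mem _
  set a : FiniteAdeleRing ℤ ℚ := ⟨af, hfin⟩ with ha
  have hav : ∀ v, a v = af v := fun v ↦ rfl
  refine ⟨a, ?_⟩
  ext q
  rw [mem_finiteAdeleSubgroup_iff_valuation]
  constructor
  · -- `H_a ⊆ H`
    intro hq
    rcases eq_or_ne q 0 with rfl | hq0
    · exact zero_mem _
    -- at each place some `h ∈ H` dominates `q`
    have hdom : ∀ v : HeightOneSpectrum ℤ, ∃ h ∈ H, h ≠ 0 ∧ v.valuation ℚ q ≤ v.valuation ℚ h := by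
      intro v
      by_cases hb : BddAbove (L v)
      · obtain ⟨h, hhH, hh0, hk⟩ : sSup (L v) ∈ L v := Int.csSup_mem (hLne v) hb
        refine ⟨h, hhH, hh0, ?_⟩
        have h1 := hq v
        rw [hav, hafval v hb] at h1
        have hne' : v.valuation ℚ h ≠ 0 := (Valuation.ne_zero_iff _).2 hh0
        rw [← exp_log hne', hk]
        calc v.valuation ℚ q = exp (sSup (L v)) * (exp (-sSup (L v)) * v.valuation ℚ q) := by
              rw [← mul_assoc, ← exp_add, add_neg_cancel, exp_zero, one_mul]
          _ ≤ exp (sSup (L v)) * 1 := mul_le_mul_right h1 _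
          _ = _ := mul_one _
      · have hex : ∃ k ∈ L v, log (v.valuation ℚ q) < k := by
          by_contra hcon
          push Not at hcon
          exact hb ⟨_, hcon⟩
        obtain ⟨k, ⟨h, hhH, hh0, rfl⟩, hlt⟩ := hex
        refine ⟨h, hhH, hh0, ?_⟩
        have hneq : v.valuation ℚ q ≠ 0 := (Valuation.ne_zero_iff _).2 hq0
        have hneh : v.valuation ℚ h ≠ 0 := (Valuation.ne_zero_iff _).2 hh0
        rw [← exp_log hneq, ← exp_log hneh, exp_le_exp]
        exact hlt.le
    -- the ideal of multipliers of `q` into `H`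
    let I : Ideal ℤ :=
      { carrier := {s : ℤ | (s : ℚ) * q ∈ H}
        add_mem' := fun {s t} hs ht ↦ by
          simp only [Set.mem_setOf_eq] at hs ht ⊢
          rw [Int.cast_add, add_mul]
          exact add_mem hs ht
        zero_mem' := by simp
        smul_mem' := fun c {s} hs ↦ by
          simp only [Set.mem_setOf_eq, smul_eq_mul] at hs ⊢
          rw [Int.cast_mul, mul_assoc, ← zsmul_eq_mul]
          exact H.zsmul_mem hs c }
    have hImem : ∀ s : ℤ, s ∈ I ↔ (s : ℚ) * q ∈ H := fun s ↦ Iff.rfl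
    by_contra hqH
    have hI1 : I ≠ ⊤ := by
      intro htop
      have h1 : (1 : ℤ) ∈ I := htop ▸ Submodule.mem_top
      rw [hImem, Int.cast_one, one_mul] at h1
      exact hqH h1
    obtain ⟨M, hM, hIM⟩ := Ideal.exists_le_maximal I hI1
    have hMbot : M ≠ ⊥ := Ring.ne_bot_of_isMaximal_of_not_isField hM Int.not_isField
    let v : HeightOneSpectrum ℤ := ⟨M, hM.isPrime, hMbot⟩
    obtain ⟨h, hhH, hh0, hle⟩ := hdom v
    set r : ℚ := q / h with hr
    have hrv : v.valuation ℚ r ≤ 1 := by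
      rw [hr, map_div₀]
      exact div_le_one_of_le₀ hle zero_le
    have hden : (r.den : ℤ) ∉ v.asIdeal := Rat.valuation_le_one_iff_den.1 hrv
    have hdenI : (r.den : ℤ) ∈ I := by
      rw [hImem]
      have hq' : q = r * h := by rw [hr, div_mul_cancel₀ _ hh0]
      have : ((r.den : ℤ) : ℚ) * q = (r.num : ℚ) * h := by
        rw [Int.cast_natCast, hq', ← mul_assoc, mul_comm (r.den : ℚ) r, Rat.mul_den_eq_num]
      rw [this, ← zsmul_eq_mul]
      exact H.zsmul_mem hhH _
    exact hden (hIM hdenI)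
  · -- `H ⊆ H_a`
    intro hq v
    rcases eq_or_ne q 0 with rfl | hq0
    · simp
    by_cases hb : BddAbove (L v)
    · rw [hav, hafval v hb]
      have hle : log (v.valuation ℚ q) ≤ sSup (L v) := le_csSup hb ⟨q, hq, hq0, rfl⟩
      have hneq : v.valuation ℚ q ≠ 0 := (Valuation.ne_zero_iff _).2 hq0
      rw [← exp_log hneq, ← exp_add, ← exp_zero, exp_le_exp]
      omega
    · rw [hav, hafzero v hb, map_zero, zero_mul]
      exact zero_le

/-- **Connes–Consani 2016, Proposition 2.5 (i)** — DISCHARGED: every non-trivial subgroup of `ℚ` is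
an `H_a`, and `H_a = H_b ⇔ b ∈ Ẑ^* a`. The source proves this via Pontrjagin duality
`Ẑ = (ℚ/ℤ)^` (closed subgroups of `Ẑ` are principal ideals place by place); here the same
place-by-place statement is proved with valuations (`exists_finiteAdeleSubgroup_eq`,
`finiteAdeleSubgroup_eq_iff`). [cite: ConnesConsani2016ArithmeticSite, Prop. 2.5 (i)] -/
theorem ConnesConsani2016_prop_2_5_holds : ConnesConsani2016_prop_2_5 :=
  ⟨fun H hH ↦ exists_finiteAdeleSubgroup_eq H hH, finiteAdeleSubgroup_eq_iff⟩


/-! ## Discharge of `ConnesConsani2016_lemma_3_7` (appended 2026-08-19, cc-1 gen 2)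

Source, proof of Lemma 3.7: `Φ(qa, qλ) = Φ(a, λ)` since `H_{qa} = q⁻¹H_a`; surjectivity: "A subgroup
`H ⊂ ℝ` whose elements are pairwise commensurable is, as an ordered group, isomorphic to a subgroup
of `ℚ`. Given `x ∈ H`, `x > 0` one can find `λ ∈ ℝ₊^×` such that `λ⁻¹x ∈ ℚ` and it follows that
`λ⁻¹H ⊂ ℚ` … `H = λH_a`"; injectivity: "`λ' = qλ` for some `q ∈ ℚ₊^×` … `H_a = qH_b = H_{q⁻¹b}`
… `b = qa`" in `𝔸^f/Ẑ^*`. We follow it, with Prop. 2.5 (i) in the form proved above. -/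

/-- Membership in `Φ(a, λ) = λH_a`. [folklore] -/
theorem mem_realScaledSubgroup {a : FiniteAdeleRing ℤ ℚ} {l x : ℝ} :
    x ∈ realScaledSubgroup a l ↔ ∃ q ∈ finiteAdeleSubgroup a, x = l * (q : ℝ) := Iff.rfl

/-- There is a place of `ℤ` (e.g. `(2)`). [folklore] -/
private theorem nonempty_heightOneSpectrum_int : Nonempty (HeightOneSpectrum ℤ) :=
  ⟨⟨Ideal.span {2}, (Ideal.span_singleton_prime two_ne_zero).2 Int.prime_two,
    by rw [Ne, Ideal.span_singleton_eq_bot]; exact two_ne_zero⟩⟩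

/-- `H_a` contains a positive rational (in particular `H_a ≠ 0`). [folklore] -/
theorem exists_pos_mem_finiteAdeleSubgroup (a : FiniteAdeleRing ℤ ℚ) :
    ∃ q ∈ finiteAdeleSubgroup a, 0 < q := by
  obtain ⟨v⟩ := nonempty_heightOneSpectrum_int
  obtain ⟨q, hq, hvq⟩ := exists_mem_finiteAdeleSubgroup_valuation_eq a v
    (-((log (Valued.v (a v))).toNat : ℤ)) (by
      calc Valued.v (a v) * exp (-((log (Valued.v (a v))).toNat : ℤ))
          ≤ exp ((log (Valued.v (a v))).toNat : ℤ) * exp (-((log (Valued.v (a v))).toNat : ℤ)) :=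
            mul_le_mul_left (le_exp_toNat_log _) _
        _ = 1 := by rw [← exp_add, add_neg_cancel, exp_zero])
  have hq0 : q ≠ 0 := by
    intro h
    rw [h, map_zero] at hvq
    exact exp_ne_zero hvq.symm
  rcases lt_or_gt_of_ne hq0 with hneg | hpos
  · exact ⟨-q, neg_mem hq, by linarith⟩
  · exact ⟨q, hq, hpos⟩

/-- `H_{qa} = q⁻¹ H_a`: `x ∈ H_{qa} ⇔ qx ∈ H_a` (`q ≠ 0`). [cite: ConnesConsani2016ArithmeticSite, Lemma 3.7 (proof)] -/
theorem mem_finiteAdeleSubgroup_smul_iff (a : FiniteAdeleRing ℤ ℚ) (q x : ℚ) :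
    x ∈ finiteAdeleSubgroup (algebraMap ℚ (FiniteAdeleRing ℤ ℚ) q * a) ↔
      q * x ∈ finiteAdeleSubgroup a := by
  rw [mem_finiteAdeleSubgroup_iff_valuation, mem_finiteAdeleSubgroup_iff_valuation]
  refine forall_congr' fun v ↦ ?_
  have hval : Valued.v (algebraMap ℚ (FiniteAdeleRing ℤ ℚ) q v) = v.valuation ℚ q :=
    valuedAdicCompletion_eq_valuation' v q
  rw [finiteAdele_mul_apply, map_mul, hval, map_mul]
  constructor <;> intro h
  · calc Valued.v (a v) * (v.valuation ℚ q * v.valuation ℚ x)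
        = v.valuation ℚ q * Valued.v (a v) * v.valuation ℚ x := by rw [mul_left_comm, ← mul_assoc]
      _ ≤ 1 := h
  · calc v.valuation ℚ q * Valued.v (a v) * v.valuation ℚ x
        = Valued.v (a v) * (v.valuation ℚ q * v.valuation ℚ x) := by rw [mul_assoc, mul_left_comm]
      _ ≤ 1 := h

/-- **Lemma 3.7, first clause:** `Φ(a, λ)` is a non-zero subgroup of `ℝ` with pairwise
commensurable elements. [cite: ConnesConsani2016ArithmeticSite, Lemma 3.7] -/
theorem isCommensurableSubgroup_realScaledSubgroup (a : FiniteAdeleRing ℤ ℚ) {l : ℝ}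
    (hl : 0 < l) : IsCommensurableSubgroup (realScaledSubgroup a l) := by
  refine ⟨fun hbot ↦ ?_, ?_⟩
  · obtain ⟨q, hq, hqpos⟩ := exists_pos_mem_finiteAdeleSubgroup a
    have hmem : l * (q : ℝ) ∈ realScaledSubgroup a l := ⟨q, hq, rfl⟩
    rw [hbot, AddSubgroup.mem_bot] at hmem
    have : (0 : ℝ) < l * (q : ℝ) := mul_pos hl (by exact_mod_cast hqpos)
    linarith
  · rintro x ⟨q, hq, rfl⟩ y ⟨q', hq', rfl⟩ hy
    have hq'0 : (q' : ℝ) ≠ 0 := by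
      intro h; apply hy; rw [h, mul_zero]
    refine ⟨q / q', ?_⟩
    push_cast
    field_simp

/-- **Lemma 3.7, surjectivity of `Φ`:** every non-zero subgroup of `ℝ` with pairwise commensurable
elements is `λH_a`. [cite: ConnesConsani2016ArithmeticSite, Lemma 3.7] -/
theorem exists_realScaledSubgroup_eq {G : AddSubgroup ℝ} (hG : IsCommensurableSubgroup G) :
    ∃ (a : FiniteAdeleRing ℤ ℚ) (l : ℝ), 0 < l ∧ realScaledSubgroup a l = G := by
  obtain ⟨hGne, hcomm⟩ := hG
  obtain ⟨y₀, hy₀G, hy₀⟩ : ∃ y ∈ G, y ≠ 0 := by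
    by_contra hcon
    push Not at hcon
    exact hGne ((AddSubgroup.eq_bot_iff_forall _).mpr hcon)
  -- a positive element
  obtain ⟨y, hyG, hy⟩ : ∃ y ∈ G, (0 : ℝ) < y := by
    rcases lt_or_gt_of_ne hy₀ with h | h
    · exact ⟨-y₀, neg_mem hy₀G, by linarith⟩
    · exact ⟨y₀, hy₀G, h⟩
  -- `H = y⁻¹ G ∩ ℚ`
  set f : ℚ →+ ℝ := (AddMonoidHom.mulLeft y).comp (Rat.castHom ℝ).toAddMonoidHom with hf
  have hfapp : ∀ r : ℚ, f r = y * (r : ℝ) := fun r ↦ rfl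
  set H : AddSubgroup ℚ := G.comap f with hH
  have hHmem : ∀ r : ℚ, r ∈ H ↔ y * (r : ℝ) ∈ G := fun r ↦ by
    rw [hH, AddSubgroup.mem_comap, hfapp]
  have hHne : H ≠ ⊥ := by
    intro h
    have h1 : (1 : ℚ) ∈ H := by rw [hHmem]; simpa using hyG
    rw [h, AddSubgroup.mem_bot] at h1
    exact one_ne_zero h1
  obtain ⟨a, ha⟩ := exists_finiteAdeleSubgroup_eq H hHne
  refine ⟨a, y, hy, ?_⟩
  ext x
  rw [mem_realScaledSubgroup, ha]
  constructor
  · rintro ⟨q, hq, rfl⟩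
    exact (hHmem q).1 hq
  · intro hx
    obtain ⟨r, hr⟩ := hcomm x hx y hyG hy.ne'
    refine ⟨r, (hHmem r).2 ?_, by rw [hr, mul_comm]⟩
    rwa [mul_comm, ← hr]

/-- **Lemma 3.7, injectivity of `Φ` modulo `ℚ₊^×`:** `λH_a = λ'H_b` iff `λ' = qλ` and `b = qa` in
`𝔸^f/Ẑ^*` for some `q ∈ ℚ₊^×`. [cite: ConnesConsani2016ArithmeticSite, Lemma 3.7] -/
theorem realScaledSubgroup_eq_iff (a b : FiniteAdeleRing ℤ ℚ) {l l' : ℝ} (hl : 0 < l)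
    (hl' : 0 < l') :
    realScaledSubgroup a l = realScaledSubgroup b l' ↔
      ∃ q : ℚ, 0 < q ∧ l' = (q : ℝ) * l ∧
        ∃ u : (FiniteAdeleRing ℤ ℚ)ˣ, IsZhatUnit u ∧
          b = (u : FiniteAdeleRing ℤ ℚ) * (algebraMap ℚ (FiniteAdeleRing ℤ ℚ) q * a) := by
  constructor
  · intro hG
    -- `λ' = qλ`
    obtain ⟨h, hh, hhpos⟩ := exists_pos_mem_finiteAdeleSubgroup b
    have hmem : l' * (h : ℝ) ∈ realScaledSubgroup a l := by
      rw [hG]; exact ⟨h, hh, rfl⟩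
    obtain ⟨k, hk, hlk⟩ := hmem
    have hhR : (0 : ℝ) < h := by exact_mod_cast hhpos
    have hkR : (0 : ℝ) < k := by
      have : (0 : ℝ) < l * (k : ℝ) := by rw [← hlk]; positivity
      exact pos_of_mul_pos_right this hl.le  -- 0 < l * k, 0 ≤ l ⟹ 0 < k
    have hkpos : (0 : ℚ) < k := by exact_mod_cast hkR
    set q : ℚ := k / h with hq
    have hqpos : 0 < q := div_pos hkpos hhpos
    have hl'q : l' = (q : ℝ) * l := by
      rw [hq]; push_cast
      field_simp
      linear_combination hlk
    refine ⟨q, hqpos, hl'q, ?_⟩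
    -- `H_{qa} = H_b`
    have hq0 : (q : ℝ) ≠ 0 := by exact_mod_cast hqpos.ne'
    have hab : finiteAdeleSubgroup (algebraMap ℚ (FiniteAdeleRing ℤ ℚ) q * a) =
        finiteAdeleSubgroup b := by
      ext x
      rw [mem_finiteAdeleSubgroup_smul_iff]
      constructor
      · intro hx
        have hmem : l * ((q * x : ℚ) : ℝ) ∈ realScaledSubgroup b l' := by
          rw [← hG]; exact ⟨q * x, hx, rfl⟩
        obtain ⟨m, hm, hlm⟩ := hmem
        have : (x : ℝ) = m := by
          rw [hl'q] at hlm
          push_cast at hlm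
          have hl0 : l ≠ 0 := hl.ne'
          field_simp at hlm
          linear_combination hlm
        have hxm : x = m := by exact_mod_cast this
        rwa [hxm]
      · intro hx
        have hmem : l' * (x : ℝ) ∈ realScaledSubgroup a l := by
          rw [hG]; exact ⟨x, hx, rfl⟩
        obtain ⟨k', hk', hlk'⟩ := hmem
        have : ((q * x : ℚ) : ℝ) = k' := by
          rw [hl'q] at hlk'
          push_cast
          have hl0 : l ≠ 0 := hl.ne'
          field_simp at hlk'
          linear_combination hlk'
        have hxk : q * x = k' := by exact_mod_cast this
        rwa [hxk]
    exact (finiteAdeleSubgroup_eq_iff _ _).1 hab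
  · rintro ⟨q, hqpos, rfl, u, hu, rfl⟩
    have hq0 : q ≠ 0 := hqpos.ne'
    -- `H_{u q a} = H_{qa} = q⁻¹ H_a`
    have hb : finiteAdeleSubgroup ((u : FiniteAdeleRing ℤ ℚ) *
        (algebraMap ℚ (FiniteAdeleRing ℤ ℚ) q * a)) =
          finiteAdeleSubgroup (algebraMap ℚ (FiniteAdeleRing ℤ ℚ) q * a) :=
      ((finiteAdeleSubgroup_eq_iff _ _).2 ⟨u, hu, rfl⟩).symm
    ext x
    rw [mem_realScaledSubgroup, mem_realScaledSubgroup, hb]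
    constructor
    · rintro ⟨k, hk, rfl⟩
      refine ⟨q⁻¹ * k, ?_, ?_⟩
      · rw [mem_finiteAdeleSubgroup_smul_iff, ← mul_assoc, mul_inv_cancel₀ hq0, one_mul]
        exact hk
      · push_cast
        field_simp
    · rintro ⟨m, hm, rfl⟩
      rw [mem_finiteAdeleSubgroup_smul_iff] at hm
      exact ⟨q * m, hm, by push_cast; ring⟩

/-- **Connes–Consani 2016, Lemma 3.7** — DISCHARGED (from Prop. 2.5 (i) as proved above and
`H_{qa} = q⁻¹H_a`). [cite: ConnesConsani2016ArithmeticSite, Lemma 3.7] -/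
theorem ConnesConsani2016_lemma_3_7_holds : ConnesConsani2016_lemma_3_7 :=
  ⟨fun a _ hl ↦ isCommensurableSubgroup_realScaledSubgroup a hl,
    fun _ hG ↦ exists_realScaledSubgroup_eq hG,
    fun a b _ _ hl hl' ↦ realScaledSubgroup_eq_iff a b hl hl'⟩

end Prop25

end Literature.NumberTheory.ConnesConsani

end
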